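import Literature.MathematicalPhysics.QuantumFieldTheory.Balaban1983to89.Beta.AveragingWardJets
import Literature.MathematicalPhysics.QuantumFieldTheory.Balaban1983to89.Beta.StepJetData

/-!
# `Balaban1983to89.Beta.AveragingWardStencils` — the STENCIL FLAVOUR of node 8: the pure-gauge background divergence
# of node 7a's packed field–multiplier stencil family `vhS` (consumed by an2 as `mfNeg (vhS d L κ′ u)`) is a CONTACT
# TERM = the commutator of the packed first-order averaging kernel with the site projector, stated in an2's EXISTING
# vocabulary (`KernelWard.divV`, `ExpKernelCalculus.comp`, `StepJetData.mfNeg`), v1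

HONEST FRAMING (page 1, mandatory).  This leaf belongs to the β sub-cell of the Bałaban audit, whose END STATEMENT is:
discharging the one-loop hypothesis `FlowStep.BetaPertH` (read at END-STATEMENT grade, RULING (R6)) makes Bałaban's
ultraviolet stability theorem for 4-d lattice Yang–Mills ([Balaban1989LargeFieldII], Thm. 1 p. 355 (B16))
UNCONDITIONAL inside this package — a real constructive-QFT result; it is NOT the continuum limit and NOT the Clay
problem.  Gloss 2: EVERYTHING below is kernel-proved [folklore] algebra of finite sums (plus two `tsum`s against a
finitely supported projector); NOTHING is cited as a fact.  [Balaban1985Averaging] (= B7) and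
[Balaban1985BackgroundPropagators] (= B9) are named only to say WHICH objects are being typed; the manuscripts under
audit are not citable for their disputed steps and no programme-internal claim enters.

ABSOLUTE RULE (cell charter, verbatim): «No internally-minted statement may enter as a cited fact. Every hypothesis is
either kernel-proved in this package or a verbatim quotation of a PUBLISHED theorem with page reference. The
manuscript(s) under audit are NOT citable for their own disputed steps — they are the thing under adjudication;
programme-internal (2001/route/tribunal) claims are never citable.»  Accordingly NO declaration below is a
`def … : Prop` carrying a citation and no hypothesis of any theorem is a printed statement: every declaration is
[folklore]; printed displays are object LOCATORS only.

THE PRINTED OBJECTS (locators only; the verbatim quotations, re-read as page images, are in the headers of node 7a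
`Beta.AveragingHessianKernels` and node 8 `Beta.AveragingWardJets`, and are not repeated as new print spans here):
B7 p.19 (11) «Ū^u = (Ū)^u» (the gauge covariance of the averaging — NOT asserted here, at any order), (14)/(15) (the
averaging operation whose letter functionals node 5 / node 7a DEFINE), B9 p.392 (3.12) (fluctuation on the LEFT of the
background: the product chart of node 7a's `vhU` / `vhKer` / `vhS`).  Nothing printed is asserted.

THE CONSUMER.  an2's `Beta.BalabanStepJets` builds the `j = 0` stencil `S₀ κ′ u := cE • wilsonA κ′ u + cVH • mfNeg
(vhS d L κ′ u) + cΛ • S^Λ κ′ u` and feeds it to `OneStepResolventKernel.vertexOf`; an2's `Beta.KernelWard.ward_hess`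
derives first-bond transversality of a resolvent Hessian from two GAUGE-COVARIANCE hypotheses of the literal shapes
(W1) `(A ∘ divV y) ∘ A = A ∘ X y − X y ∘ A` and (W2) `divW y ν y′ = X y ∘ V ν y′ − V ν y′ ∘ X y`.  RULING (R26) P6c /
(R28-2) name the an1-owed instance «averaging jets: background-gauge covariance at SECOND order»; (R28-3): P6c is a
hypothesis of socket/END theorems only.  Node 8 proved the letter-level law (K-V2) `vhKer_div_right` for the UNPACKED
kernel `m_b = vhKer`.  THIS LEAF packs it: for the very object an2 consumes, `mfNeg (vhS d L κ′ u)`, the pure-gauge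
backward divergence in the FINE BACKGROUND bond index — literally an2's `KernelWard.divV` — is computed in closed form,
entrywise AND as a commutator of `ExpKernelCalculus.comp`-products, i.e. in the (W2) SHAPE, using only vocabulary that
is ALREADY in the tree.  No (W1′)/(W2′) `JetData` schema is typed or pre-empted here (that is an2's to state); when it
lands, its averaging instance is the theorems below BY NAME.  Nothing is assumed; no printed-looking statement is
concluded.

WHAT IS PROVED (all [folklore], sorry-free; fine sites `Fin (d+1) → ℤ`, colours `Fib d = Fin (d+1) ⊕ Fin (d+1)`
(`inl` = fluctuation-field legs, `inr` = multiplier legs), `q¹ = linKer`, `m = vhKer` of node 7a):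
§1 CONVENTIONS BRIDGE `B6BondElimination.unitVec = AffineAveraging.unitVec` (`b6UnitVec_eq`): an2's `divV` and node
   5's `grad` shift by the same unit vectors.
§2 TWO PACKED OBJECTS in an2's index types: `linSym d L : MKer (d+1) (Fib d)`, the SYMMETRIC packing of the first-order
   averaging kernel — entry `((x, inl α), (z, inr μ)) ↦ q¹_{(μ, z/L)}(α, x)` when `z ∈ L·ℤ^{d+1}` (else `0`), its twin on
   `(inr, inl)`, zero diagonal blocks; it IS node 7a's packer applied to `linKer` (`packVH_linKer`), and it is symmetric
   (`linSym_symm`) — and `siteP u : MKer (d+1) (Fib d)`, the colour-diagonal PROJECTOR onto the legs based at the fine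
   site `u` (entry `[x = u][z = u][a = b]`), with `comp K (siteP u) = [z = u] · K` and `comp (siteP u) K = [x = u] · K`
   entrywise (`comp_siteP`, `siteP_comp`; the `tsum` in `comp` is against a finitely supported factor).
§3 PER-BLOCK DIVERGENCE OF `vhS` (`1 ≤ L`): `divV (vhS d L) u x z (inl α) (inr μ) = ([z = u] − [x = u]) · linSym …`
   (`divV_vhS_inl_inr`), `divV (vhS d L) u x z (inr μ) (inl α) = ([x = u] − [z = u]) · linSym …` (`divV_vhS_inr_inl`),
   zero on the diagonal blocks (`divV_vhS_inl_inl`, `divV_vhS_inr_inr`).  The OPPOSITE signs on the two off-diagonal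
   blocks are why the block-sign adapter `mfNeg` (an2's convention) is the packing with the uniform law:
§4 (S-V) THE STENCIL WARD LAW: `divV (fun κ′ u => mfNeg (vhS d L κ′ u)) u x z a b = ([z = u] − [x = u]) · linSym d L x z a b`
   for ALL colours (`divV_mfNeg_vhS`; helper `divV_mfNeg : divV (mfNeg ∘∘ V) = mfNeg (divV V)`), and its COMMUTATOR FORM
     `divV (fun κ′ u => mfNeg (vhS d L κ′ u)) u = comp (linSym d L) (siteP u) − comp (siteP u) (linSym d L)`
   (`divV_mfNeg_vhS_eq_comm`) — the (W2) shape `X ∘ V′ − V′ ∘ X` with `V′ = linSym` (first jet) and generator `−siteP u`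
   (equivalently `siteP u ∘ V′ − V′ ∘ siteP u` with the sign moved: `divV … = −(comp (siteP u) linSym − comp linSym (siteP u))`,
   `divV_mfNeg_vhS_eq_neg_comm`).  Corollary: AWAY FROM THE LEGS the stencil is transversal — `z ≠ u → x ≠ u →
   divV (mfNeg ∘∘ vhS) u x z a b = 0` (`divV_mfNeg_vhS_eq_zero`).
READING (informal, not used): under the background variation `B ↦ B + d(δ_u)` at the fine site `u`, the (V-H) stencil
responds only by the generator of the gauge rotation at `u` acting on its two legs — on the fluctuation leg `(α, x)`
(the letters `W` rotate at their INITIAL points, node 8 (W-V2) `iniC`) and on the multiplier leg at the coarse site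
`z = c₋` (the conjugation `[λ(c₋), Z W]` of the averaged variable) — each time producing the FIRST-order kernel `q¹`.
This is the colour-stripped, letter-level shadow at `U = 1` of B7 (11) one order up; (11) itself is not asserted.

WHAT IS NOT PROVED / NOT CLAIMED: nothing printed; no statement about `Φ_b` / logarithms (node 7b); nothing about the
additive-chart twin `vhSadd` (its divergence has contact terms at both endpoints of both bonds — node 8 (K-H) — and is
not of projector form; not needed by an2's product-chart sockets); nothing about the fluctuation-leg laws (K-H)/(K-V1)
in packed form; nothing about `wilsonA` / `S^Λ` (an3's / an2's pieces of `S₀`), `vertexOf`, `KInv`, (W1′)/(W2′), (R1),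
(K1·), P6c, `BetaPertH`.  Value = the an1 piece of the (W2)-type gauge-covariance datum of `S₀`, typed on the consumed
object in the consumer's vocabulary.

Provenance: cell pub-balaban, β sub-cell, lineage an1, gen 12 (2026-08-19), node 8b of the an1 plan; imports node 8
`Beta.AveragingWardJets` (⇒ 7a) and an2's `Beta.StepJetData` (⇒ `Beta.KernelWard`, `Beta.ExpKernelCalculus`).
-/

open Finset
open Literature.MathematicalPhysics.QuantumFieldTheory.Balaban1983to89
open Literature.MathematicalPhysics.QuantumFieldTheory.Balaban1983to89.Beta
open AveragingContours (blk off)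
open AveragingHessianKernels (Bond linKer vhKer packVH packVH_inl_inr packVH_inr_inl packVH_inl_inl packVH_inr_inr vhS
  eq_smul_blk_of_off_eq_zero)
open AveragingWardJets (vhKer_div_right)
open ExpKernelCalculus (MKer comp)
open OneStepResolventKernel (Fib)
open StepJetData (mfNeg mfNeg_inl_inl mfNeg_inl_inr mfNeg_inr_inl mfNeg_inr_inr)
open KernelWard (divV)


namespace Literature.MathematicalPhysics.QuantumFieldTheory.Balaban1983to89.Beta.AveragingWardStencils

noncomputable section

variable {d : ℕ}

/-! ## §1 Conventions bridge -/

/-- [folklore] an2's unit lattice vector (`B6BondElimination.unitVec μ i = [i = μ]`, used by `KernelWard.divV`) is node 5's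
(`AffineAveraging.unitVec = Pi.single μ 1`, used by `grad` and by node 8's divergence laws). -/
theorem b6UnitVec_eq (μ : Fin (d + 1)) :
    B6BondElimination.unitVec μ = AffineAveraging.unitVec μ := by
  funext i
  rw [B6BondElimination.unitVec_apply, AffineAveraging.unitVec_apply]

/-! ## §2 The packed first-order kernel `linSym` and the site projector `siteP` -/

/-- [folklore] THE SYMMETRICALLY PACKED FIRST-ORDER AVERAGING KERNEL in an2's index types: entry
`((x, inl α), (z, inr μ)) ↦ q¹_{(μ, z/L)}((α, x)) = linKer L μ (blk L z) (α, x)` when `z` is the fine image of a coarse site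
(`off L z = 0`), else `0`; the symmetric twin on `(inr, inl)`; `0` on the diagonal blocks (same conventions as node 7a's
packer `packVH`, cf. `packVH_linKer`). -/
def linSym (d L : ℕ) : MKer (d + 1) (Fib d) := fun x z a b =>
  match a, b with
  | Sum.inl α, Sum.inr μ => if off L z = 0 then linKer L μ (blk L z) (α, x) else 0
  | Sum.inr μ, Sum.inl α => if off L x = 0 then linKer L μ (blk L x) (α, z) else 0
  | Sum.inl _, Sum.inl _ => 0
  | Sum.inr _, Sum.inr _ => 0

/-- [folklore] The `(inl, inr)` entries of `linSym`. -/
@[simp] theorem linSym_inl_inr (L : ℕ) (x z : Fin (d + 1) → ℤ) (α μ : Fin (d + 1)) :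
    linSym d L x z (Sum.inl α) (Sum.inr μ) = if off L z = 0 then linKer L μ (blk L z) (α, x) else 0 := rfl

/-- [folklore] The `(inr, inl)` entries of `linSym`. -/
@[simp] theorem linSym_inr_inl (L : ℕ) (x z : Fin (d + 1) → ℤ) (μ α : Fin (d + 1)) :
    linSym d L x z (Sum.inr μ) (Sum.inl α) = if off L x = 0 then linKer L μ (blk L x) (α, z) else 0 := rfl

/-- [folklore] `linSym` vanishes on the field–field block. -/
@[simp] theorem linSym_inl_inl (L : ℕ) (x z : Fin (d + 1) → ℤ) (α α' : Fin (d + 1)) :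
    linSym d L x z (Sum.inl α) (Sum.inl α') = 0 := rfl

/-- [folklore] `linSym` vanishes on the multiplier–multiplier block. -/
@[simp] theorem linSym_inr_inr (L : ℕ) (x z : Fin (d + 1) → ℤ) (μ μ' : Fin (d + 1)) :
    linSym d L x z (Sum.inr μ) (Sum.inr μ') = 0 := rfl

/-- [folklore] `linSym` IS node 7a's packer applied to the first-order kernel (read as a kernel ignoring its background
bond argument), for every value of the packer's background-bond index. -/
theorem packVH_linKer (L : ℕ) (κ' : Fin (d + 1)) (u : Fin (d + 1) → ℤ) :
    packVH (fun μ y f _ => linKer L μ y f) L κ' u = linSym d L := by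
  funext x z a b
  rcases a with α | μ <;> rcases b with α' | μ' <;> rfl

/-- [folklore] `linSym` is symmetric. -/
theorem linSym_symm (L : ℕ) (x z : Fin (d + 1) → ℤ) (a b : Fib d) : linSym d L x z a b = linSym d L z x b a := by
  rcases a with α | μ <;> rcases b with α' | μ' <;> rfl

/-- [folklore] THE SITE PROJECTOR at the fine site `u`: the colour-diagonal kernel `[x = u][z = u][a = b]` (the
colour-stripped generator of the background gauge rotation at `u`, acting on every leg based at `u`). -/
def siteP (u : Fin (d + 1) → ℤ) : MKer (d + 1) (Fib d) := fun x z a b => if x = u ∧ z = u ∧ a = b then 1 else 0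

/-- [folklore] The entries of the site projector. -/
theorem siteP_apply (u x z : Fin (d + 1) → ℤ) (a b : Fib d) :
    siteP u x z a b = if x = u ∧ z = u ∧ a = b then 1 else 0 := rfl

/-- [folklore] RIGHT MULTIPLICATION BY THE PROJECTOR restricts the second leg to `u`: `comp K (siteP u) = [z = u] · K`
entrywise (the `tsum` defining `comp` has a single nonzero term). -/
theorem comp_siteP (K : MKer (d + 1) (Fib d)) (u x z : Fin (d + 1) → ℤ) (a b : Fib d) :
    comp K (siteP u) x z a b = (if z = u then 1 else 0) * K x z a b := by
  unfold ExpKernelCalculus.comp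
  have hin : ∀ y : Fin (d + 1) → ℤ,
      (∑ f, K x y a f * siteP u y z f b) = if y = u then (if z = u then K x y a b else 0) else 0 := by
    intro y
    by_cases hy : y = u
    · by_cases hz : z = u
      · simp [siteP_apply, hy, hz, mul_ite, Finset.sum_ite_eq']
      · simp [siteP_apply, hy, hz]
    · simp [siteP_apply, hy]
  simp_rw [hin]
  rw [tsum_ite_eq]
  by_cases hz : z = u
  · subst hz; simp
  · simp [hz]

/-- [folklore] LEFT MULTIPLICATION BY THE PROJECTOR restricts the first leg to `u`: `comp (siteP u) K = [x = u] · K`. -/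
theorem siteP_comp (K : MKer (d + 1) (Fib d)) (u x z : Fin (d + 1) → ℤ) (a b : Fib d) :
    comp (siteP u) K x z a b = (if x = u then 1 else 0) * K x z a b := by
  unfold ExpKernelCalculus.comp
  have hin : ∀ y : Fin (d + 1) → ℤ,
      (∑ f, siteP u x y a f * K y z f b) = if y = u then (if x = u then K y z a b else 0) else 0 := by
    intro y
    by_cases hy : y = u
    · by_cases hx : x = u
      · simp [siteP_apply, hy, hx, ite_mul, Finset.sum_ite_eq]
      · simp [siteP_apply, hy, hx]
    · simp [siteP_apply, hy]
  simp_rw [hin]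
  rw [tsum_ite_eq]
  by_cases hx : x = u
  · subst hx; simp
  · simp [hx]

/-! ## §3 The per-block divergence of `vhS` in the fine background bond index -/

/-- [folklore] **THE `(inl, inr)` BLOCK**: for the fluctuation leg `(α, x)` and the multiplier leg `(μ, z)`,
`Σ_κ′ (vhS κ′ (u − e_κ′) − vhS κ′ u)((x, inl α), (z, inr μ)) = ([z = u] − [x = u]) · q¹` — node 8's (K-V2)
`vhKer_div_right` read through node 7a's packer (the coarse site `c₋ = L • blk L z` IS `z` on the packer's support). -/
theorem divV_vhS_inl_inr {L : ℕ} (hL : 1 ≤ L) (u x z : Fin (d + 1) → ℤ) (α μ : Fin (d + 1)) :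
    divV (vhS d L) u x z (Sum.inl α) (Sum.inr μ)
      = ((if z = u then 1 else 0) - (if x = u then 1 else 0)) * linSym d L x z (Sum.inl α) (Sum.inr μ) := by
  simp only [KernelWard.divV, Finset.sum_apply, Pi.sub_apply, vhS, packVH_inl_inr, linSym_inl_inr]
  by_cases hz : off L z = 0
  · simp only [hz, if_true, b6UnitVec_eq]
    rw [vhKer_div_right hL, ← eq_smul_blk_of_off_eq_zero hL hz]
  · simp [hz]

/-- [folklore] **THE `(inr, inl)` BLOCK** (the packer's symmetric twin: the roles of the two legs are exchanged, hence the
OPPOSITE sign): `… ((x, inr μ), (z, inl α)) = ([x = u] − [z = u]) · q¹`. -/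
theorem divV_vhS_inr_inl {L : ℕ} (hL : 1 ≤ L) (u x z : Fin (d + 1) → ℤ) (μ α : Fin (d + 1)) :
    divV (vhS d L) u x z (Sum.inr μ) (Sum.inl α)
      = ((if x = u then 1 else 0) - (if z = u then 1 else 0)) * linSym d L x z (Sum.inr μ) (Sum.inl α) := by
  simp only [KernelWard.divV, Finset.sum_apply, Pi.sub_apply, vhS, packVH_inr_inl, linSym_inr_inl]
  by_cases hx : off L x = 0
  · simp only [hx, if_true, b6UnitVec_eq]
    rw [vhKer_div_right hL, ← eq_smul_blk_of_off_eq_zero hL hx]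
  · simp [hx]

/-- [folklore] The divergence vanishes on the field–field block (so does `vhS`). -/
theorem divV_vhS_inl_inl (L : ℕ) (u x z : Fin (d + 1) → ℤ) (α α' : Fin (d + 1)) :
    divV (vhS d L) u x z (Sum.inl α) (Sum.inl α') = 0 := by
  simp [KernelWard.divV, Finset.sum_apply, vhS]

/-- [folklore] The divergence vanishes on the multiplier–multiplier block (so does `vhS`). -/
theorem divV_vhS_inr_inr (L : ℕ) (u x z : Fin (d + 1) → ℤ) (μ μ' : Fin (d + 1)) :
    divV (vhS d L) u x z (Sum.inr μ) (Sum.inr μ') = 0 := by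
  simp [KernelWard.divV, Finset.sum_apply, vhS]

/-! ## §4 (S-V) The stencil Ward law for `mfNeg (vhS …)` and its commutator form -/

/-- [folklore] The block-sign adapter commutes with the divergence (it is additive, entry by entry). -/
theorem divV_mfNeg (V : Fin (d + 1) → (Fin (d + 1) → ℤ) → MKer (d + 1) (Fib d)) (u : Fin (d + 1) → ℤ) :
    divV (fun κ' v => mfNeg (V κ' v)) u = mfNeg (divV V u) := by
  funext x z a b
  rcases a with α | μ <;> rcases b with α' | μ' <;>
    simp [KernelWard.divV, Finset.sum_apply, Pi.sub_apply, Finset.sum_sub_distrib, Finset.sum_add_distrib,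
      Finset.sum_neg_distrib]
  -- the `(inr, inl)` block: `−Σ A + Σ B = Σ B − Σ A`
  ring

/-- [folklore] **(S-V) THE STENCIL WARD LAW.**  For the field–multiplier stencil family exactly as an2 consumes it,
`mfNeg (vhS d L κ′ u)`, the pure-gauge backward divergence in the fine background bond index (an2's `KernelWard.divV`)
is the CONTACT TERM `([z = u] − [x = u]) · linSym d L x z a b`, uniformly in the colours. -/
theorem divV_mfNeg_vhS {L : ℕ} (hL : 1 ≤ L) (u x z : Fin (d + 1) → ℤ) (a b : Fib d) :
    divV (fun κ' v => mfNeg (vhS d L κ' v)) u x z a b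
      = ((if z = u then 1 else 0) - (if x = u then 1 else 0)) * linSym d L x z a b := by
  rw [divV_mfNeg]
  rcases a with α | μ <;> rcases b with α' | μ'
  · simp [divV_vhS_inl_inl]
  · rw [mfNeg_inl_inr, divV_vhS_inl_inr hL]
  · rw [mfNeg_inr_inl, divV_vhS_inr_inl hL]; ring
  · simp [divV_vhS_inr_inr]

/-- [folklore] **(S-V), COMMUTATOR FORM — the (W2) SHAPE**: `divV (mfNeg ∘∘ vhS) u = linSym ∘ siteP u − siteP u ∘ linSym`
(`∘ = ExpKernelCalculus.comp`): the pure-gauge background divergence of the second-order stencil is the commutator of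
the FIRST-order stencil with the site projector. -/
theorem divV_mfNeg_vhS_eq_comm {L : ℕ} (hL : 1 ≤ L) (u : Fin (d + 1) → ℤ) :
    divV (fun κ' v => mfNeg (vhS d L κ' v)) u = comp (linSym d L) (siteP u) - comp (siteP u) (linSym d L) := by
  funext x z a b
  simp only [Pi.sub_apply, comp_siteP, siteP_comp, divV_mfNeg_vhS hL]
  ring

/-- [folklore] The same with the generator written on the left: `divV (mfNeg ∘∘ vhS) u = −(siteP u ∘ linSym − linSym ∘ siteP u)`. -/
theorem divV_mfNeg_vhS_eq_neg_comm {L : ℕ} (hL : 1 ≤ L) (u : Fin (d + 1) → ℤ) :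
    divV (fun κ' v => mfNeg (vhS d L κ' v)) u = -(comp (siteP u) (linSym d L) - comp (linSym d L) (siteP u)) := by
  rw [divV_mfNeg_vhS_eq_comm hL, neg_sub]

/-- [folklore] **TRANSVERSALITY AWAY FROM THE LEGS**: if the varied site `u` is neither leg's site, the divergence vanishes. -/
theorem divV_mfNeg_vhS_eq_zero {L : ℕ} (hL : 1 ≤ L) {u x z : Fin (d + 1) → ℤ} (hz : z ≠ u) (hx : x ≠ u) (a b : Fib d) :
    divV (fun κ' v => mfNeg (vhS d L κ' v)) u x z a b = 0 := by
  simp [divV_mfNeg_vhS hL, hz, hx]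

/-- [folklore] The unadapted family: the same vanishing away from the legs. -/
theorem divV_vhS_eq_zero {L : ℕ} (hL : 1 ≤ L) {u x z : Fin (d + 1) → ℤ} (hz : z ≠ u) (hx : x ≠ u) (a b : Fib d) :
    divV (vhS d L) u x z a b = 0 := by
  rcases a with α | μ <;> rcases b with α' | μ'
  · exact divV_vhS_inl_inl L u x z α α'
  · simp [divV_vhS_inl_inr hL, hz, hx]
  · simp [divV_vhS_inr_inl hL, hz, hx]
  · exact divV_vhS_inr_inr L u x z μ μ'

end

end Literature.MathematicalPhysics.QuantumFieldTheory.Balaban1983to89.Beta.AveragingWardStencils
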